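import Summits.ABC.StewartYu.PrincipalUnitLatticeKummer
import Summits.ABC.StewartYu.WeightedLatticeCramer
import HarnessLib

/-!
# Reduction of `p`-adic linear forms in logarithms of primes to Kummer-free principal generators

Cell topic `Summits/ABC/StewartYu` (cell abc-stewartyu, HOME `run/shared/lean/pub/abc-stewartyu/`, seat p1); namespace
`Summit.ABC.StewartYu.PrincipalLattice` (theorems only; the main theorem of WP-M — the geometry-of-numbers lemmas it uses are in
`WeightedLatticeBasis.lean` / `WeightedLatticeCramer.lean`).

Main result `exists_principal_generators` (work package **WP-M** of the kernel `p`-adic Baker bound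
for logarithms of rational primes; its statement is the cell's skeleton interface `WPM`, verbatim).
For an odd prime `p`, distinct primes `q₁, …, q_m ≠ p` and `e ∈ ℤ^m ∖ {0}` with
`ord_p(∏ qᵢ^{eᵢ} − 1) ≥ 1`, there are `α₁, …, α_m ∈ ℚ` and `e' ∈ ℤ^m ∖ {0}` such that:
`ord_p(αⱼ − 1) ≥ 1`; the `αⱼ` are multiplicatively independent; no non-empty sub-product of the
`αⱼ` is a square in `ℚ`; `∏ qᵢ^{eᵢ} = ∏ αⱼ^{e'ⱼ}`; `∏ h(αⱼ) ≤ m^{2m} p ∏ log qᵢ`;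
`|e'ⱼ| ≤ m^{2m} p (∏ log qᵢ) max|eᵢ|`; `log p ≤ 2 h(αⱼ)`. So a `p`-adic lower bound for linear forms
in the `p`-adic logarithms of Kummer-free PRINCIPAL units of `ℚ` (to which the tree's
Cijsouw–Waldschmidt / Waldschmidt 1980 descent applies verbatim over `ℚ_p`) yields one for distinct
primes, the prime `p` being paid once (linearly) through the index of the lattice.

Proof. `αⱼ = α̃(bⱼ)` for a `ℤ`-basis `b` of the signed principal-unit lattice `Λ^±`
(`Summits/ABC/StewartYu/PrincipalUnitLattice*.lean`) chosen by the geometry of numbers: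

* `volume_weighted_lt_one` / `_le_one`: the weighted cross-polytope `{∑ wᵢ|xᵢ| < 1}` has volume
  `2^m/(m! ∏ wᵢ)` (Mathlib's `volume_sum_rpow_lt_one`, `p = 1`, and a diagonal change of variables);
* `exists_basis_prod_weighted_le`: a finite-index `L ≤ ℤ^m` (index `d`) has a `ℤ`-basis with
  `∏ⱼ F(bⱼ) ≤ (m!)² d ∏ wᵢ`, `F(x) = ∑ wᵢ|xᵢ|` — Minkowski's second theorem and Mahler's basis theorem,
  both PROVED in the tree for `ℤ^m` (`Dioph.exists_directional_system_prod_mul_volume_le`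
  [cite: EvertseGyory2015, Thm 4.3.1 (p. 70)], `Dioph.exists_int_basis_le_of_directional`
  [cite: EvertseGyory2015, Thm 4.3.3 (p. 70)]), transported to `L` by a basis matrix;
* `card_mul_abs_repr_mul_prod_le`: Cramer's rule and Evertse–Győry's Lemma 4.3.6
  (`Dioph.abs_det_le_of_seminorm`, proved in the tree) bound basis coordinates:
  `d |cⱼ| ∏ wᵢ ≤ F(x) ∏_{k≠j} F(b_k)`;
* `factorial_sq_mul_le`: `(m!)² m ≤ 3 (log 2)^m m^{2m}` (so that `(m!)² F(e)/F(bⱼ)` fits the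
  interface's `m^{2m} p (∏ log qᵢ) max|eᵢ|`, using `F(bⱼ) ≥ log 2`, `∑ log qᵢ ≤ m ∏ log qᵢ/(log 2)^{m−1}`,
  `p ≥ 3`).

With `wᵢ = log qᵢ`: `h(αⱼ) ≤ F(bⱼ)`, `d ≤ p − 1`, `(m!)² ≤ m^{2m}` give the heights product; the
Kummer condition, independence, congruences and the identity (sign `+1` as `p ≠ 2`) are the basis
lemmas of `Summits/ABC/StewartYu/PrincipalUnitLatticeKummer.lean`. Everything is [folklore] geometry of numbers; the only
printed inputs (Minkowski, Mahler, Lemma 4.3.6) were already proved in the tree.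

## References

* [EvertseGyory2015] J.-H. Evertse, K. Győry, *Unit Equations in Diophantine Number Theory*,
  Cambridge Stud. Adv. Math. 146, CUP 2015 — Thm 4.3.1, Thm 4.3.3 (p. 70), Lemma 4.3.6 (p. 72).
-/

noncomputable section

namespace Summit.ABC.StewartYu.PrincipalLattice

open Module Finset Height

/-! ### The reduction theorem (WP-M): principal, Kummer-free generators -/

/-- **Reduction to signed principal-unit generators** (work package WP-M of the kernel `p`-adic
Baker bound; the statement is `AbcStewartYuPlan.WPM` of the cell's skeleton, verbatim). Let `p`
be an odd prime, `q₁, …, q_m` distinct primes `≠ p` and `e ∈ ℤ^m ∖ {0}` with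
`ord_p(∏ qᵢ^{eᵢ} − 1) ≥ 1`. Then there are rationals `α₁, …, α_m` and `e' ∈ ℤ^m ∖ {0}` with:
`αⱼ ≡ 1 (mod p)` (`ord_p(αⱼ − 1) ≥ 1`); the `αⱼ` multiplicatively independent; no non-empty
sub-product of the `αⱼ` a square in `ℚ` (the Kummer condition of the Cijsouw–Waldschmidt descent);
`∏ qᵢ^{eᵢ} = ∏ αⱼ^{e'ⱼ}`; `∏ h(αⱼ) ≤ m^{2m} · p · ∏ log qᵢ`;
`|e'ⱼ| ≤ m^{2m} · p · (∏ log qᵢ) · max|eᵢ|`; and `log p ≤ 2 h(αⱼ)`.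
Construction: `αⱼ = α̃(bⱼ) = χ(bⱼ) ∏ qᵢ^{bⱼᵢ}` for a `ℤ`-basis `b` of the signed principal-unit
lattice `Λ^± = {z : ∏ qᵢ^{zᵢ} ≡ ±1 (mod p)}` (index `d ≤ p − 1`) with
`∏ⱼ F(bⱼ) ≤ (m!)² d ∏ log qᵢ`, `F(z) = ∑ |zᵢ| log qᵢ ≥ h(α̃(z))` (Minkowski's second theorem +
Mahler's basis theorem, `exists_basis_prod_weighted_le`); `e ∈ Λ^±` and `e'` = its coordinates
(Cramer: `|e'ⱼ| F(bⱼ) ≤ (m!)² F(e)`, `card_mul_abs_repr_mul_prod_le`); the sign of `∏ αⱼ^{e'ⱼ}`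
is `+1` as `p ≠ 2` (`prod_signedProd_zpow_repr`); Kummer-freeness is
`not_isSquare_prod_signedProd_basis`; the numerical step is `(m!)² m ≤ 3 (log 2)^m m^{2m}` and
`∑ log qᵢ ≤ m (∏ log qᵢ)/(log 2)^{m−1}`. [folklore] -/
theorem exists_principal_generators :
    ∀ (p : ℕ), p.Prime → p ≠ 2 → ∀ (m : ℕ) (q : Fin m → ℕ),
    (∀ i, (q i).Prime) → Function.Injective q → (∀ i, q i ≠ p) →
    ∀ (e : Fin m → ℤ), e ≠ 0 → 1 ≤ padicValRat p (∏ i, (q i : ℚ) ^ e i - 1) →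
    ∃ (α : Fin m → ℚ) (e' : Fin m → ℤ),
      (∀ j, α j ≠ 0 ∧ 1 ≤ padicValRat p (α j - 1)) ∧
      (∀ μ : Fin m → ℤ, ∏ j, α j ^ μ j = 1 → μ = 0) ∧
      (∀ T : Finset (Fin m), T.Nonempty → ¬ IsSquare (∏ j ∈ T, α j)) ∧
      e' ≠ 0 ∧ ∏ i, (q i : ℚ) ^ e i = ∏ j, α j ^ e' j ∧
      (∏ j, logHeight₁ (α j)) ≤ (m : ℝ) ^ (2 * m) * p * ∏ i, Real.log (q i) ∧
      (∀ j, (|e' j| : ℝ) ≤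
        (m : ℝ) ^ (2 * m) * p * (∏ i, Real.log (q i)) * (Finset.univ.sup fun i => (e i).natAbs)) ∧
      (∀ j, Real.log p ≤ 2 * logHeight₁ (α j)) := by
  intro p hp hp2 m q hq hinj hqp e he hval
  classical
  haveI := Fact.mk hp
  -- `m = 0` is impossible
  rcases Nat.eq_zero_or_pos m with hm | hm
  · subst hm; exact absurd (funext fun i => Fin.elim0 i) he
  have hq0 : ∀ i, ((q i : ℕ) : ZMod p) ≠ 0 := fun i h =>
    hqp i (((Nat.prime_dvd_prime_iff_eq hp (hq i)).mp ((ZMod.natCast_eq_zero_iff _ _).mp h)).symm)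
  -- weights `wᵢ = log qᵢ`
  set w : Fin m → ℝ := fun i => Real.log (q i) with hw
  have hwpos : ∀ i, 0 < w i := fun i => Real.log_pos (by exact_mod_cast (hq i).one_lt)
  have hwge : ∀ i, Real.log 2 ≤ w i := fun i =>
    Real.log_le_log two_pos (by exact_mod_cast (hq i).two_le)
  have hΩ : 0 < ∏ i, w i := Finset.prod_pos fun i _ => hwpos i
  have hL : (0.6931471803 : ℝ) < Real.log 2 := Real.log_two_gt_d9
  have hL0 : 0 < Real.log 2 := by linarith
  -- the lattice `Λ^±` and its index `d ≤ p − 1`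
  set L := latPMSub q hq0 with hLdef
  have hidx := index_latPM_le q hq0
  have hcardL : Nat.card ((Fin m → ℤ) ⧸ L) = (latPM q hq0).index := rfl
  haveI : Finite ((Fin m → ℤ) ⧸ L) :=
    Nat.finite_of_card_ne_zero (by rw [hcardL]; exact hidx.2.ne')
  set d : ℕ := Nat.card ((Fin m → ℤ) ⧸ L) with hd
  have hd0 : 0 < d := by rw [hcardL]; exact hidx.2
  have hdp : (d : ℝ) ≤ p := by
    have h1 : d ≤ p - 1 := by rw [hcardL]; exact hidx.1
    have h2 : p - 1 ≤ p := Nat.sub_le p 1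
    exact_mod_cast h1.trans h2
  -- the good basis and the generators
  obtain ⟨b, hb⟩ := exists_basis_prod_weighted_le hm L w hwpos
  have heker := expHom_eq_zero_of_one_le_padicValRat q hq hqp hq0 hval
  have heΛ : e ∈ latPM q hq0 := mem_latPM_of_one_le_padicValRat q hq hqp hq0 hval
  set eL : L := ⟨e, heΛ⟩ with heL
  set α : Fin m → ℚ := fun j => signedProd q hq0 (b j : Fin m → ℤ) with hα
  set e' : Fin m → ℤ := fun j => b.equivFun eL j with he'
  have hbne : ∀ j, ((b j : L) : Fin m → ℤ) ≠ 0 := fun j h =>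
    b.ne_zero j (Subtype.ext h)
  have hα1 : ∀ j, 1 ≤ padicValRat p (α j - 1) := fun j =>
    one_le_padicValRat_signedProd_sub_one q hq hinj hqp hq0 (b j).2 (hbne j)
  -- the weighted norms `F(b_j) ≥ log 2` and `F(e) ≤ B ∑ wᵢ`
  set Fb : Fin m → ℝ := fun j => ∑ i, w i * |(((b j : L) : Fin m → ℤ) i : ℝ)| with hFb
  have hFb_ge : ∀ j, Real.log 2 ≤ Fb j := by
    intro j
    obtain ⟨i, hi⟩ : ∃ i, ((b j : L) : Fin m → ℤ) i ≠ 0 := by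
      by_contra h; push Not at h; exact hbne j (funext h)
    have h1 : (1 : ℝ) ≤ |(((b j : L) : Fin m → ℤ) i : ℝ)| := by
      rw [← Int.cast_abs]; exact_mod_cast Int.one_le_abs hi
    calc Real.log 2 ≤ w i * |(((b j : L) : Fin m → ℤ) i : ℝ)| := by
          nlinarith [hwge i, hwpos i]
      _ ≤ Fb j := Finset.single_le_sum (f := fun i => w i * |(((b j : L) : Fin m → ℤ) i : ℝ)|)
          (fun k _ => mul_nonneg (hwpos k).le (abs_nonneg _)) (Finset.mem_univ i)
  have hFb_pos : ∀ j, 0 < Fb j := fun j => hL0.trans_le (hFb_ge j)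
  set Bmax : ℝ := ((Finset.univ.sup fun i => (e i).natAbs : ℕ) : ℝ) with hBmax
  have hBmax0 : 0 ≤ Bmax := Nat.cast_nonneg _
  have heB : ∀ i, |(e i : ℝ)| ≤ Bmax := by
    intro i
    rw [← Int.cast_abs, show ((|e i| : ℤ) : ℝ) = ((e i).natAbs : ℝ) by
      rw [Nat.cast_natAbs], hBmax]
    exact_mod_cast Finset.le_sup (f := fun i => (e i).natAbs) (Finset.mem_univ i)
  have hFe : ∑ i, w i * |(e i : ℝ)| ≤ Bmax * ∑ i, w i := by
    rw [Finset.mul_sum]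
    exact Finset.sum_le_sum fun i _ => by
      rw [mul_comm Bmax]; exact mul_le_mul_of_nonneg_left (heB i) (hwpos i).le
  -- `(log 2)^{m-1} ∑ wᵢ ≤ m ∏ wᵢ`
  have hsumw : Real.log 2 ^ (m - 1) * ∑ i, w i ≤ m * ∏ i, w i := by
    rw [Finset.mul_sum]
    have h1 : ∀ i, Real.log 2 ^ (m - 1) * w i ≤ ∏ k, w k := by
      intro i
      rw [← Finset.mul_prod_erase Finset.univ w (Finset.mem_univ i), mul_comm]
      refine mul_le_mul_of_nonneg_left ?_ (hwpos i).le
      have hcard : (Finset.univ.erase i).card = m - 1 := by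
        rw [Finset.card_erase_of_mem (Finset.mem_univ i), Finset.card_univ, Fintype.card_fin]
      calc Real.log 2 ^ (m - 1) = ∏ _k ∈ Finset.univ.erase i, Real.log 2 := by
            rw [Finset.prod_const, hcard]
        _ ≤ ∏ k ∈ Finset.univ.erase i, w k :=
            Finset.prod_le_prod (fun k _ => hL0.le) fun k _ => hwge k
    calc ∑ i, Real.log 2 ^ (m - 1) * w i ≤ ∑ _i : Fin m, ∏ k, w k :=
          Finset.sum_le_sum fun i _ => h1 i
      _ = m * ∏ i, w i := by rw [Finset.sum_const, Finset.card_univ, Fintype.card_fin]; ring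
  -- numerical constants
  have hfact := factorial_sq_mul_le m
  have hp3 : (3 : ℝ) ≤ p := by
    have := hp.two_le
    have h3 : 3 ≤ p := by omega
    exact_mod_cast h3
  have hmfac : ((m.factorial : ℝ)) ^ 2 ≤ (m : ℝ) ^ (2 * m) := by
    rw [pow_mul', ← Nat.cast_pow]
    have := Nat.factorial_le_pow m
    exact_mod_cast pow_le_pow_left₀ (Nat.cast_nonneg _) (show (m.factorial : ℝ) ≤ (m ^ m : ℕ) by
      exact_mod_cast this) 2
  refine ⟨α, e', fun j => ⟨?_, hα1 j⟩, ?_, ?_, ?_, ?_, ?_, ?_, fun j => ?_⟩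
  · -- `αⱼ ≠ 0`
    rw [hα]
    simp only
    unfold signedProd
    refine mul_ne_zero ?_ (prod_zpow_pos q hq _).ne'
    rcases unitSign_eq_or q hq0 ((b j : L) : Fin m → ℤ) with h | h <;> rw [h] <;> norm_num
  · -- multiplicative independence
    exact fun μ hμ => signedProd_basis_independent q hq0 b hq hinj μ hμ
  · -- Kummer condition
    exact fun T hT => not_isSquare_prod_signedProd_basis q hq0 b hq hinj T hT
  · -- `e' ≠ 0`
    intro h0
    apply he
    have h1 : b.equivFun eL = 0 := funext fun j => congrFun h0 j
    have h2 : eL = 0 := (LinearEquiv.map_eq_zero_iff _).mp h1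
    exact congrArg Subtype.val h2
  · -- the identity
    exact prod_signedProd_zpow_repr q hq0 b hq hp2 heker heΛ
  · -- heights product
    calc ∏ j, logHeight₁ (α j) ≤ ∏ j, Fb j :=
          Finset.prod_le_prod (fun j _ => Height.zero_le_logHeight₁ _)
            fun j _ => logHeight₁_signedProd_le q hq hq0 _
      _ ≤ (m.factorial : ℝ) ^ 2 * d * ∏ i, w i := hb
      _ ≤ (m : ℝ) ^ (2 * m) * p * ∏ i, w i := by gcongr
  · -- the exponents `e'`
    intro j
    have hcr := card_mul_abs_repr_mul_prod_le hm L b w hwpos eL j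
    rw [← hd] at hcr
    have he'j : (b.repr eL j : ℝ) = (e' j : ℝ) := by
      rw [he']; simp only [Module.Basis.equivFun_apply]
    rw [he'j] at hcr
    -- `d |e'ⱼ| Ω Fb j ≤ F(e) ∏ Fb ≤ F(e) (m!)² d Ω`
    have h1 : (d : ℝ) * |(e' j : ℝ)| * (∏ i, w i) * Fb j ≤
        (∑ i, w i * |(e i : ℝ)|) * ((m.factorial : ℝ) ^ 2 * d * ∏ i, w i) := by
      have h2 := mul_le_mul_of_nonneg_right hcr (hFb_pos j).le
      have h3 : (∏ k ∈ Finset.univ.erase j, Fb k) * Fb j = ∏ k, Fb k := by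
        rw [mul_comm, Finset.mul_prod_erase _ _ (Finset.mem_univ j)]
      calc (d : ℝ) * |(e' j : ℝ)| * (∏ i, w i) * Fb j
          ≤ (∑ i, w i * |(e i : ℝ)|) * (∏ k ∈ Finset.univ.erase j, Fb k) * Fb j := h2
        _ = (∑ i, w i * |(e i : ℝ)|) * ∏ k, Fb k := by rw [mul_assoc, h3]
        _ ≤ (∑ i, w i * |(e i : ℝ)|) * ((m.factorial : ℝ) ^ 2 * d * ∏ i, w i) :=
            mul_le_mul_of_nonneg_left hb
              (Finset.sum_nonneg fun i _ => mul_nonneg (hwpos i).le (abs_nonneg _))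
    -- cancel `d Ω > 0`: `|e'ⱼ| Fb j ≤ (m!)² F(e)`
    have h4 : |(e' j : ℝ)| * Fb j ≤ (m.factorial : ℝ) ^ 2 * ∑ i, w i * |(e i : ℝ)| := by
      have hdΩ : (0 : ℝ) < d * ∏ i, w i := mul_pos (by exact_mod_cast hd0) hΩ
      have : (d * ∏ i, w i) * (|(e' j : ℝ)| * Fb j) ≤
          (d * ∏ i, w i) * ((m.factorial : ℝ) ^ 2 * ∑ i, w i * |(e i : ℝ)|) := by
        calc (d * ∏ i, w i) * (|(e' j : ℝ)| * Fb j)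
            = (d : ℝ) * |(e' j : ℝ)| * (∏ i, w i) * Fb j := by ring
          _ ≤ (∑ i, w i * |(e i : ℝ)|) * ((m.factorial : ℝ) ^ 2 * d * ∏ i, w i) := h1
          _ = (d * ∏ i, w i) * ((m.factorial : ℝ) ^ 2 * ∑ i, w i * |(e i : ℝ)|) := by ring
      exact le_of_mul_le_mul_left this hdΩ
    -- `|e'ⱼ| (log 2)^m ≤ (m!)² Bmax (log 2)^{m-1} ∑ w ≤ (m!)² m Bmax Ω ≤ 3 (log 2)^m m^{2m} Bmax Ω`
    have h5 : |(e' j : ℝ)| * Real.log 2 ^ m ≤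
        3 * Real.log 2 ^ m * (m : ℝ) ^ (2 * m) * Bmax * ∏ i, w i := by
      have hm1 : Real.log 2 ^ m = Real.log 2 ^ (m - 1) * Real.log 2 :=
        (pow_sub_one_mul hm.ne' _).symm
      calc |(e' j : ℝ)| * Real.log 2 ^ m
          = (|(e' j : ℝ)| * Real.log 2) * Real.log 2 ^ (m - 1) := by rw [hm1]; ring
        _ ≤ (|(e' j : ℝ)| * Fb j) * Real.log 2 ^ (m - 1) :=
            mul_le_mul_of_nonneg_right (mul_le_mul_of_nonneg_left (hFb_ge j) (abs_nonneg _))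
              (by positivity)
        _ ≤ ((m.factorial : ℝ) ^ 2 * (Bmax * ∑ i, w i)) * Real.log 2 ^ (m - 1) :=
            mul_le_mul_of_nonneg_right
              (h4.trans (mul_le_mul_of_nonneg_left hFe (by positivity))) (by positivity)
        _ = (m.factorial : ℝ) ^ 2 * Bmax * (Real.log 2 ^ (m - 1) * ∑ i, w i) := by ring
        _ ≤ (m.factorial : ℝ) ^ 2 * Bmax * (m * ∏ i, w i) :=
            mul_le_mul_of_nonneg_left hsumw (by positivity)
        _ = ((m.factorial : ℝ) ^ 2 * m) * Bmax * ∏ i, w i := by ring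
        _ ≤ (3 * Real.log 2 ^ m * (m : ℝ) ^ (2 * m)) * Bmax * ∏ i, w i := by gcongr
        _ = 3 * Real.log 2 ^ m * (m : ℝ) ^ (2 * m) * Bmax * ∏ i, w i := by ring
    have h6 : |(e' j : ℝ)| ≤ 3 * (m : ℝ) ^ (2 * m) * Bmax * ∏ i, w i := by
      have hLm : (0 : ℝ) < Real.log 2 ^ m := by positivity
      have : Real.log 2 ^ m * |(e' j : ℝ)| ≤
          Real.log 2 ^ m * (3 * (m : ℝ) ^ (2 * m) * Bmax * ∏ i, w i) := by
        calc Real.log 2 ^ m * |(e' j : ℝ)| = |(e' j : ℝ)| * Real.log 2 ^ m := mul_comm _ _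
          _ ≤ _ := h5
          _ = Real.log 2 ^ m * (3 * (m : ℝ) ^ (2 * m) * Bmax * ∏ i, w i) := by ring
      exact le_of_mul_le_mul_left this hLm
    calc |(e' j : ℝ)| ≤ 3 * (m : ℝ) ^ (2 * m) * Bmax * ∏ i, w i := h6
      _ ≤ (p : ℝ) * (m : ℝ) ^ (2 * m) * Bmax * ∏ i, w i := by gcongr
      _ = (m : ℝ) ^ (2 * m) * p * (∏ i, w i) * Bmax := by ring
  · -- the floor
    exact log_le_two_mul_logHeight₁ hp2 (hα1 j)

end Summit.ABC.StewartYu.PrincipalLattice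

end
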